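import Summits.Ventures.CertifiedManyBodySolver.Observables.PairLROTowerStationaryReading
import Summits.Ventures.CertifiedManyBodySolver.Observables.RungLeavesTTPrime
import Summits.Ventures.CertifiedManyBodySolver.Observables.RungLeavesSummit
import Summits.Ventures.CertifiedManyBodySolver.Observables.PairBoxWordD4
import Summits.Ventures.CertifiedManyBodySolver.Rows.DopedTLCorrAffine
import HarnessLib

/-!
# Ventures/CertifiedManyBodySolver — Observables/RungLeavesPairAnchor.lean

HONEST FRAMING: first certified bounds on pairing observables — CEILINGS and two-sided WINDOWS at positivity scale; a
ceiling never speaks to the presence of pairing; not a superconductivity verdict; nothing in this file is a number.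

Cell `hubbard-obs` (D-0042), seat p1 (pair correlator), `prover-hubbard-obs-p1-g7-0`. **ANCHOR-GENERIC PAIRING LEAVES for
the burst era** (pairing twin of p2's `Observables/RungLeavesStiffnessAnchor.lean`). Every pairing leaf so far
(`M3ObsPairLROCeilingAt[_tp0]`, `M3ObsPairWindowAt[_tp0]`, `M3ObsODLROCeilingAt[_tp0]`) is pinned to `(U, n) = (8, 7/8)`; the
burst's anchor grid is not (BURST-INPUTS-obs.md §0 item 5: A4 `(8, 4/5, 0)`, A5 `(8, 15/16, 0)`, A6 `(6, 7/8, 0)`, A7 `(4, 7/8, 0)`,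
…; menu per anchor: `F₂` up, `P_d(2,1)` ±, ONE one-point OP1-E/OP1-S edge). For an ARBITRARY anchor `(U, n, t′)` (`t = 1`):
* §1 leaf shapes `ObsPairLROCeilingAt tp U n c` (SUMMIT format: for every family of unit `(rectN n L, S^z = 0)`-sector ground
  states of `hubbardTorusTT' L 1 tp U`, `liminf_k |Λ_{2k}|⁻² Σ_{x,y∈Λ_{2k}} P_d(2k; x, y) ≤ c`), `ObsPairWindowAt tp U n r W`
  (two-sided window of width `≤ W` on the `D₄`-class-mean pair correlator `P̄_d(r)` over the torus-limit class),
  `ObsODLROCeilingAt tp U n c` (`d`-wave pair Bragg weight at `k = 0` of every torus-limit ground state `≤ c`);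
* §2 at `(8, 7/8)` they ARE the M3 leaves (`_m3_iff`, `_m3_tp0_iff`: `Iff.rfl`); monotone transport; `.intro`;
* §3 BOX ROUTE (`F_B` node shape): one `D₄`-orbit LOWER row `SquareTTPrimeCorrOrbitLowerRow tp U n u r S Λ_B (−pairBoxWord B)`
  + the cap `e₀(U, n, t′) ≤ u` ⇒ BOTH ODLRO leaves at every `c ≥ −r/|B|²` (`liminf_dWavePairFieldLRO_le_of_orbitLowerRow_neg`,
  `braggWeight_le_neg_div_of_pairBox_orbitLowerRow`, already generic; a plain upper row is the `S = {1}` case via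
  `squareTTPrimeCorrOrbitLowerRow_singleton_one_iff`); AFFINE orbit row of
  Rows/DopedTLCorrAffine under ANY later certified window (`…_of_affineOrbitRow` = the fast layer in leaf form);
* §4 PAIR WINDOWS from two orbit rows at `(0, r)` and from two AFFINE orbit rows under any later window;
* §5 ONE-POINT dischargers from the OP1-E / OP1-S claim-node shapes (torus-level orbit-state bound; p1 g4–g6
  `liminf_pairFieldLRO_le_sq_of_onePoint[_stationary]_orbitState_bound_TT'`, generic) at the sharp tower constant `M²`
  (the KHvdL `2M²` by `.mono`), the `t′ = 0` `hubbardTorus` vocabulary, and — NEW — the ONE-POINT FAST LAYER (`…_reprice`): a node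
  certified at cap `u` with energy multiplier `κ ≥ 0` re-prices under any certified cap `hi` to `M' = M − κ(u − hi)` at zero solves
  (the node's `κ(u − e)` term IS the affine term; no new node shape needed).
So a burst anchor needs ZERO new theory for its pairing edges: claim node ⇒ one line ⇒ leaf. No named fact, zero computation,
no `sorry`; every discharger is CONDITIONAL on the rows / caps / nodes it names. Identity-form OP1-E certificates read through
`liminf_pairFieldLRO_le_sq_of_onePoint_variational_certificate_TT'` (PairLROTowerCeilingCert) directly, also generic.

References: D. J. Scalapino, Phys. Rep. 250 (1995) 329, §2 eq. (2.4) [Scalapino1995]; T. Koma, H. Tasaki, J. Stat. Phys. 76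
(1994) 745, Theorems 2.2 and 5 [KomaTasaki1994]; S. Boyd, L. Vandenberghe, Convex Optimization (2004) §5.6 [BoydVandenberghe2004].
-/

noncomputable section

namespace Summit.Ventures.CertifiedManyBodySolver.Observables

open Matrix Complex Finset Literature.MathematicalPhysics.QuantumLattice Literature.Probability.LatticeModels
open Literature.MathematicalPhysics.QuantumLattice.HubbardWave0 ThermodynamicLimit Filter Topology
open Literature.MathematicalPhysics.QuantumManyBody.StateRelaxation
open Summit.Ventures.CertifiedManyBodySolver.Transport
open MeasureTheory
open scoped ComplexOrder ComplexConjugate BigOperators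

/-! ## §1 The three pairing leaf shapes at an arbitrary anchor `(U, n, t′)` -/

/-- **Summit-format pair-LRO ceiling `c` at the anchor `(U, n, t′)`.** For every family `ψ_L` of unit
`(rectN n L, S^z = 0)`-sector ground states of `hubbardTorusTT' L 1 tp U`,
`liminf_k |Λ_{2k}|⁻² Σ_{x,y∈Λ_{2k}} P_d(2k; x, y) ≤ c` (the box-averaged torus `d`-wave pair-field correlator whose
`liminf > 0` IS the LRO clause of `HubbardSuperconductivity`, even sides). At `(8, 7/8)` this is `M3ObsPairLROCeilingAt tp c`.
A ceiling; says nothing about presence. [cite: Scalapino1995, §2 eq. (2.4)] -/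
def ObsPairLROCeilingAt (tp U n : ℝ) (c : ℚ) : Prop :=
  ∀ (ψ : ∀ L, Fock (Orb (FermionTorus 2 L))),
    (∀ L, IsGroundStateInSector (hubbardTorusTT' L 1 tp U) (rectN n L) 0 (ψ L)) →
    (∀ L, star (ψ L) ⬝ᵥ ψ L = 1) →
    liminf (fun k : ℕ => (∑ x ∈ halfOpenBox 2 (2 * k), ∑ y ∈ halfOpenBox 2 (2 * k),
        torusPullback (pairFieldCorr dWaveFormFactor ψ) (2 * k) x y) /
          ((#(halfOpenBox 2 (2 * k)) : ℝ)) ^ 2) atTop ≤ ((c : ℚ) : ℝ)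

/-- **Two-sided window of width `≤ W` on the `D₄`-class-mean pair correlator `P̄_d(r)` at the anchor `(U, n, t′)`:**
`∃ lo hi : ℚ, lo ≤ hi ∧ hi − lo ≤ W ∧` for every torus limit `ω` of unit `(rectN n L, S^z = 0)`-sector ground states of
`hubbardTorusTT' L 1 tp U` along `Ls → ∞`, `lo ≤ P̄_d(r)(ω) ≤ hi` (`P̄_d` = RungLeaves `dWavePairClassMean`). At `(8, 7/8)`
this is `M3ObsPairWindowAt tp r W`. [cite: Scalapino1995, §2 eq. (2.4)] -/
def ObsPairWindowAt (tp U n : ℝ) (r : Site 2) (W : ℚ) : Prop :=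
  ∃ lo hi : ℚ, lo ≤ hi ∧ hi - lo ≤ W ∧
    ∀ (ω : InfVolFermionState 2) (Ls : ℕ → ℕ) (ψ : ∀ L, Fock (Orb (FermionTorus 2 L))),
      Tendsto Ls atTop atTop →
      (∀ j, IsGroundStateInSector (hubbardTorusTT' (Ls j) 1 tp U) (rectN n (Ls j)) 0 (ψ (Ls j))) →
      (∀ j, star (ψ (Ls j)) ⬝ᵥ ψ (Ls j) = 1) → ω.IsTorusLimitOf ψ Ls →
      ((lo : ℚ) : ℝ) ≤ dWavePairClassMean ω r ∧ dWavePairClassMean ω r ≤ ((hi : ℚ) : ℝ)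

/-- **Ceiling `c` on the `d`-wave pair Bragg weight at `k = 0` (ODLRO density) at the anchor `(U, n, t′)`:** for every
torus limit `ω` of the class and every finite spectral measure `μ` of its pair correlator `r ↦ ω.dWavePairCorr 0 r`,
`braggWeight μ {0} ≤ c`. At `(8, 7/8)` this is `M3ObsODLROCeilingAt tp c`. A ceiling; says nothing about presence.
[cite: Scalapino1995, §2 eq. (2.4)] -/
def ObsODLROCeilingAt (tp U n : ℝ) (c : ℚ) : Prop :=
  ∀ (ω : InfVolFermionState 2) (Ls : ℕ → ℕ) (ψ : ∀ L, Fock (Orb (FermionTorus 2 L))),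
    Tendsto Ls atTop atTop →
    (∀ j, IsGroundStateInSector (hubbardTorusTT' (Ls j) 1 tp U) (rectN n (Ls j)) 0 (ψ (Ls j))) →
    (∀ j, star (ψ (Ls j)) ⬝ᵥ ψ (Ls j) = 1) → ω.IsTorusLimitOf ψ Ls →
    ∀ (μ : Measure (EuclideanSpace ℝ (Fin 2))) [IsFiniteMeasure μ],
      (∀ r : Site 2, ∫ ξ, exp ((∑ i, (r i : ℝ) * ξ i : ℝ) * I) ∂μ = ω.dWavePairCorr 0 r) →
      braggWeight μ ![(0 : Fin 2 → ℝ)] ≤ ((c : ℚ) : ℝ)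

/-! ## §2 At `(U, n) = (8, 7/8)` the anchor leaves ARE the M3 leaves; transport -/

/-- At `(8, 7/8, t′)`: `ObsPairLROCeilingAt tp 8 (7/8) c ↔ M3ObsPairLROCeilingAt tp c` (definitional). -/
theorem obsPairLROCeilingAt_m3_iff (tp : ℝ) (c : ℚ) : ObsPairLROCeilingAt tp 8 (7 / 8) c ↔ M3ObsPairLROCeilingAt tp c := Iff.rfl

/-- At `(8, 7/8, 0)`: `ObsPairLROCeilingAt 0 8 (7/8) c ↔ M3ObsPairLROCeilingAt_tp0 c` (the registry's `t′ = 0` leaf shape). -/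
theorem obsPairLROCeilingAt_m3_tp0_iff (c : ℚ) : ObsPairLROCeilingAt 0 8 (7 / 8) c ↔ M3ObsPairLROCeilingAt_tp0 c := Iff.rfl

/-- At `(8, 7/8, t′)`: `ObsPairWindowAt tp 8 (7/8) r W ↔ M3ObsPairWindowAt tp r W` (definitional). -/
theorem obsPairWindowAt_m3_iff (tp : ℝ) (r : Site 2) (W : ℚ) :
    ObsPairWindowAt tp 8 (7 / 8) r W ↔ M3ObsPairWindowAt tp r W := Iff.rfl

/-- At `(8, 7/8, 0)`: `ObsPairWindowAt 0 8 (7/8) r W ↔ M3ObsPairWindowAt_tp0 r W`. -/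
theorem obsPairWindowAt_m3_tp0_iff (r : Site 2) (W : ℚ) : ObsPairWindowAt 0 8 (7 / 8) r W ↔ M3ObsPairWindowAt_tp0 r W := Iff.rfl

/-- At `(8, 7/8, t′)`: `ObsODLROCeilingAt tp 8 (7/8) c ↔ M3ObsODLROCeilingAt tp c` (definitional). -/
theorem obsODLROCeilingAt_m3_iff (tp : ℝ) (c : ℚ) : ObsODLROCeilingAt tp 8 (7 / 8) c ↔ M3ObsODLROCeilingAt tp c := Iff.rfl

/-- At `(8, 7/8, 0)`: `ObsODLROCeilingAt 0 8 (7/8) c ↔ M3ObsODLROCeilingAt_tp0 c`. -/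
theorem obsODLROCeilingAt_m3_tp0_iff (c : ℚ) : ObsODLROCeilingAt 0 8 (7 / 8) c ↔ M3ObsODLROCeilingAt_tp0 c := Iff.rfl

/-- Monotone transport. -/
theorem ObsPairLROCeilingAt.mono {tp U n : ℝ} {c c' : ℚ} (h : ObsPairLROCeilingAt tp U n c) (hcc : c ≤ c') :
    ObsPairLROCeilingAt tp U n c' := fun ψ hψ hψ1 => (h ψ hψ hψ1).trans (by exact_mod_cast hcc)

/-- Monotone transport. -/
theorem ObsPairWindowAt.mono {tp U n : ℝ} {r : Site 2} {W W' : ℚ} (h : ObsPairWindowAt tp U n r W) (hW : W ≤ W') :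
    ObsPairWindowAt tp U n r W' := by
  obtain ⟨lo, hi, hle, hw, hall⟩ := h
  exact ⟨lo, hi, hle, hw.trans hW, hall⟩

/-- Monotone transport. -/
theorem ObsODLROCeilingAt.mono {tp U n : ℝ} {c c' : ℚ} (h : ObsODLROCeilingAt tp U n c) (hcc : c ≤ c') :
    ObsODLROCeilingAt tp U n c' := fun ω Ls ψ h1 h2 h3 h4 μ _ hμ => (h ω Ls ψ h1 h2 h3 h4 μ hμ).trans (by exact_mod_cast hcc)

/-- Introduction from an explicit certified `[lo, hi]` on the class mean (the node files' `…_window_of` shape). -/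
theorem ObsPairWindowAt.intro {tp U n : ℝ} {r : Site 2} {lo hi W : ℚ} (hle : lo ≤ hi) (hW : hi - lo ≤ W)
    (h : ∀ (ω : InfVolFermionState 2) (Ls : ℕ → ℕ) (ψ : ∀ L, Fock (Orb (FermionTorus 2 L))),
      Tendsto Ls atTop atTop →
      (∀ j, IsGroundStateInSector (hubbardTorusTT' (Ls j) 1 tp U) (rectN n (Ls j)) 0 (ψ (Ls j))) →
      (∀ j, star (ψ (Ls j)) ⬝ᵥ ψ (Ls j) = 1) → ω.IsTorusLimitOf ψ Ls →
      ((lo : ℚ) : ℝ) ≤ dWavePairClassMean ω r ∧ dWavePairClassMean ω r ≤ ((hi : ℚ) : ℝ)) :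
    ObsPairWindowAt tp U n r W :=
  ⟨lo, hi, hle, hW, h⟩

/-! ## §3 Box route (`F_B` nodes) at any anchor: orbit row / upper row / affine orbit row ⇒ both ODLRO leaves -/

/-- **One certified `D₄`-orbit LOWER row on `−pairBoxWord B` + the cap ⇒ the summit-format leaf** at every `c ≥ −r/|B|²`
(`1 ∈ S`, `B ≠ ∅`; `liminf_dWavePairFieldLRO_le_of_orbitLowerRow_neg`). [cite: Scalapino1995, §2 eq. (2.4)] -/
theorem ObsPairLROCeilingAt_of_orbitRow {tp U n : ℝ} {u r c : ℚ} {S : Finset (DihedralGroup 4)}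
    (h1 : (1 : DihedralGroup 4) ∈ S) {B : Finset (Site 2)} (hB : B.Nonempty)
    (hrow : SquareTTPrimeCorrOrbitLowerRow tp U n u r S (B.biUnion (pairRegion (insert (0 : Site 2) unitSteps)))
      (-pairBoxWord (insert (0 : Site 2) unitSteps) dWaveFormFactor B))
    (hu : energyDensityTT' 1 tp U n ≤ ((u : ℚ) : ℝ)) (hc : -((r : ℚ) : ℝ) / ((B.card : ℝ)) ^ 2 ≤ ((c : ℚ) : ℝ)) :
    ObsPairLROCeilingAt tp U n c :=
  fun ψ hψ hψ1 => (liminf_dWavePairFieldLRO_le_of_orbitLowerRow_neg h1 hB hrow hu ψ hψ hψ1).trans hc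

/-- **One certified `D₄`-orbit LOWER row on `−pairBoxWord B` + the cap ⇒ the Bragg (ODLRO-density) leaf** at every
`c ≥ −r/|B|²` (`S ≠ ∅`, `B ≠ ∅`; `braggWeight_le_neg_div_of_pairBox_orbitLowerRow`). [cite: Scalapino1995, §2 eq. (2.4)] -/
theorem ObsODLROCeilingAt_of_orbitRow {tp U n : ℝ} {u r c : ℚ} {S : Finset (DihedralGroup 4)} (hS : S.Nonempty)
    {B : Finset (Site 2)} (hB : B.Nonempty)
    (hrow : SquareTTPrimeCorrOrbitLowerRow tp U n u r S (B.biUnion (pairRegion (insert (0 : Site 2) unitSteps)))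
      (-pairBoxWord (insert (0 : Site 2) unitSteps) dWaveFormFactor B))
    (hu : energyDensityTT' 1 tp U n ≤ ((u : ℚ) : ℝ)) (hc : -((r : ℚ) : ℝ) / ((B.card : ℝ)) ^ 2 ≤ ((c : ℚ) : ℝ)) :
    ObsODLROCeilingAt tp U n c :=
  fun ω Ls ψ hLs hψ hψ1 hω μ _ hμ =>
    (braggWeight_le_neg_div_of_pairBox_orbitLowerRow hS hB hrow ω Ls ψ hLs hψ hψ1 hω hu μ hμ).trans hc

/-- **One `F_B`-type orbit row discharges BOTH ODLRO leaves** (Bragg and summit format) at every `c ≥ −r/|B|²` (`1 ∈ S`). -/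
theorem obs_odlro_and_pairLRO_of_orbitRow {tp U n : ℝ} {u r c : ℚ} {S : Finset (DihedralGroup 4)}
    (h1 : (1 : DihedralGroup 4) ∈ S) {B : Finset (Site 2)} (hB : B.Nonempty)
    (hrow : SquareTTPrimeCorrOrbitLowerRow tp U n u r S (B.biUnion (pairRegion (insert (0 : Site 2) unitSteps)))
      (-pairBoxWord (insert (0 : Site 2) unitSteps) dWaveFormFactor B))
    (hu : energyDensityTT' 1 tp U n ≤ ((u : ℚ) : ℝ)) (hc : -((r : ℚ) : ℝ) / ((B.card : ℝ)) ^ 2 ≤ ((c : ℚ) : ℝ)) :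
    ObsODLROCeilingAt tp U n c ∧ ObsPairLROCeilingAt tp U n c :=
  ⟨ObsODLROCeilingAt_of_orbitRow ⟨1, h1⟩ hB hrow hu hc, ObsPairLROCeilingAt_of_orbitRow h1 hB hrow hu hc⟩

/-- **THE FAST LAYER for `F_B` edges (both ODLRO leaves).** An AFFINE orbit row on `−pairBoxWord B`
(`q + κhi(hi − e₀) + κlo(e₀ − lo) ≤ orbit mean`, `κhi, κlo ≥ 0`) read under ANY certified window `lo' ≤ e₀(U, n, t′) ≤ hi'`
gives both leaves at every `c ≥ −reprice(q; hi, lo; κhi, κlo; hi', lo')/|B|²` — a better cap `hi'` tightens the ceiling by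
exactly `κhi(hi − hi')/|B|²` at zero solves. [cite: BoydVandenberghe2004, §5.6] -/
theorem obs_odlro_and_pairLRO_of_affineOrbitRow {tp U n : ℝ} {q hi lo κhi κlo hi' lo' c : ℚ}
    {S : Finset (DihedralGroup 4)} (h1 : (1 : DihedralGroup 4) ∈ S) {B : Finset (Site 2)} (hB : B.Nonempty)
    (hrow : SquareTTPrimeCorrAffineOrbitLowerRow tp U n q hi lo κhi κlo S
      (B.biUnion (pairRegion (insert (0 : Site 2) unitSteps)))
      (-pairBoxWord (insert (0 : Site 2) unitSteps) dWaveFormFactor B))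
    (hκhi : 0 ≤ κhi) (hκlo : 0 ≤ κlo) (hlo' : ((lo' : ℚ) : ℝ) ≤ energyDensityTT' 1 tp U n)
    (hhi' : energyDensityTT' 1 tp U n ≤ ((hi' : ℚ) : ℝ))
    (hc : -((reprice q hi lo κhi κlo hi' lo' : ℚ) : ℝ) / ((B.card : ℝ)) ^ 2 ≤ ((c : ℚ) : ℝ)) :
    ObsODLROCeilingAt tp U n c ∧ ObsPairLROCeilingAt tp U n c :=
  obs_odlro_and_pairLRO_of_orbitRow h1 hB (hrow.orbitLowerRow_of_floor hκhi hκlo hlo') hhi' hc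

/-! ## §4 Pair windows at any anchor: two orbit rows at `(0, r)`; two affine orbit rows under any later window -/

/-- **Two certified `D₄`-orbit rows at `(0, r)` ⇒ the window**: a row with constant `qlo` on the two-point pair word at `(0, r)`
and one with constant `qup` on its NEGATION (both `S = univ`, threshold `u`), plus the cap `e₀(U, n, t′) ≤ u`, give
`ObsPairWindowAt tp U n r W` for every `W ≥ (−qup) − qlo` (dictionary `squareTTPrimeCorrOrbitLowerRow_dWavePair_iff` /
`expect_d4Emb_dWavePairWord`). [cite: Scalapino1995, §2 eq. (2.4)] -/
theorem ObsPairWindowAt_of_orbitRows {tp U n : ℝ} {r : Site 2} {u qlo qup W : ℚ}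
    (hlo : SquareTTPrimeCorrOrbitLowerRow tp U n u qlo Finset.univ
      (pairRegion (insert (0 : Site 2) unitSteps) 0 ∪ pairRegion (insert (0 : Site 2) unitSteps) r)
      (fermionEmbed (PolySite.incl Finset.subset_union_left)
          (localPairAt (insert (0 : Site 2) unitSteps) dWaveFormFactor 0)ᴴ *
        fermionEmbed (PolySite.incl Finset.subset_union_right)
          (localPairAt (insert (0 : Site 2) unitSteps) dWaveFormFactor r)))
    (hup : SquareTTPrimeCorrOrbitLowerRow tp U n u qup Finset.univ
      (pairRegion (insert (0 : Site 2) unitSteps) 0 ∪ pairRegion (insert (0 : Site 2) unitSteps) r)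
      (-(fermionEmbed (PolySite.incl Finset.subset_union_left)
          (localPairAt (insert (0 : Site 2) unitSteps) dWaveFormFactor 0)ᴴ *
        fermionEmbed (PolySite.incl Finset.subset_union_right)
          (localPairAt (insert (0 : Site 2) unitSteps) dWaveFormFactor r))))
    (hu : energyDensityTT' 1 tp U n ≤ ((u : ℚ) : ℝ)) (hq : qlo ≤ -qup) (hW : -qup - qlo ≤ W) :
    ObsPairWindowAt tp U n r W := by
  refine ⟨qlo, -qup, hq, by linarith, fun ω Ls ψ h1 h2 h3 h4 => ?_⟩
  have hl := (squareTTPrimeCorrOrbitLowerRow_dWavePair_iff tp U n u qlo Finset.univ r).1 hlo ω Ls ψ h1 h2 h3 h4 hu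
  have hu' := hup ω Ls ψ h1 h2 h3 h4 hu
  have hneg : ∀ γ : DihedralGroup 4,
      (ω.expect (d4ShiftSet γ 0 (pairRegion (insert (0 : Site 2) unitSteps) 0 ∪
          pairRegion (insert (0 : Site 2) unitSteps) r))
        (fermionEmbed (PolySite.d4Emb γ 0 (pairRegion (insert (0 : Site 2) unitSteps) 0 ∪
            pairRegion (insert (0 : Site 2) unitSteps) r))
          (-(fermionEmbed (PolySite.incl Finset.subset_union_left)
              (localPairAt (insert (0 : Site 2) unitSteps) dWaveFormFactor 0)ᴴ *
            fermionEmbed (PolySite.incl Finset.subset_union_right)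
              (localPairAt (insert (0 : Site 2) unitSteps) dWaveFormFactor r))))).re =
      -(ω.dWavePairCorr 0 (d4Vec γ r)).re := fun γ => by
    rw [map_neg, map_neg, Complex.neg_re, expect_d4Emb_dWavePairWord, add_zero, add_zero,
      (d4Vec_eq_zero_iff γ 0).2 rfl]
  simp only [hneg, Finset.sum_neg_distrib, mul_neg] at hu'
  refine ⟨?_, ?_⟩
  · simpa [dWavePairClassMean] using hl
  · have : dWavePairClassMean ω r ≤ -((qup : ℚ) : ℝ) := by
      unfold dWavePairClassMean; linarith
    simpa using this

/-- **THE FAST LAYER for pair windows.** Two AFFINE orbit rows at `(0, r)` (on the pair word, value `qlo`, multipliers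
`κhi κlo`; on its negation, value `qup`, multipliers `κhi' κlo'`; all multipliers `≥ 0`) read under ANY certified window
`lo'' ≤ e₀(U, n, t′) ≤ hi''` give the window of width `(−reprice qup …) − reprice qlo …` — both edges re-priced at zero solves.
[cite: BoydVandenberghe2004, §5.6] -/
theorem ObsPairWindowAt_of_affineOrbitRows {tp U n : ℝ} {r : Site 2}
    {qlo hi lo κhi κlo qup hi' lo' κhi' κlo' hi'' lo'' W : ℚ}
    (hlo : SquareTTPrimeCorrAffineOrbitLowerRow tp U n qlo hi lo κhi κlo Finset.univ
      (pairRegion (insert (0 : Site 2) unitSteps) 0 ∪ pairRegion (insert (0 : Site 2) unitSteps) r)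
      (fermionEmbed (PolySite.incl Finset.subset_union_left)
          (localPairAt (insert (0 : Site 2) unitSteps) dWaveFormFactor 0)ᴴ *
        fermionEmbed (PolySite.incl Finset.subset_union_right)
          (localPairAt (insert (0 : Site 2) unitSteps) dWaveFormFactor r)))
    (hup : SquareTTPrimeCorrAffineOrbitLowerRow tp U n qup hi' lo' κhi' κlo' Finset.univ
      (pairRegion (insert (0 : Site 2) unitSteps) 0 ∪ pairRegion (insert (0 : Site 2) unitSteps) r)
      (-(fermionEmbed (PolySite.incl Finset.subset_union_left)
          (localPairAt (insert (0 : Site 2) unitSteps) dWaveFormFactor 0)ᴴ *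
        fermionEmbed (PolySite.incl Finset.subset_union_right)
          (localPairAt (insert (0 : Site 2) unitSteps) dWaveFormFactor r))))
    (hκhi : 0 ≤ κhi) (hκlo : 0 ≤ κlo) (hκhi' : 0 ≤ κhi') (hκlo' : 0 ≤ κlo')
    (hlo'' : ((lo'' : ℚ) : ℝ) ≤ energyDensityTT' 1 tp U n) (hhi'' : energyDensityTT' 1 tp U n ≤ ((hi'' : ℚ) : ℝ))
    (hq : reprice qlo hi lo κhi κlo hi'' lo'' ≤ -reprice qup hi' lo' κhi' κlo' hi'' lo'')
    (hW : -reprice qup hi' lo' κhi' κlo' hi'' lo'' - reprice qlo hi lo κhi κlo hi'' lo'' ≤ W) :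
    ObsPairWindowAt tp U n r W :=
  ObsPairWindowAt_of_orbitRows (hlo.orbitLowerRow_of_floor hκhi hκlo hlo'')
    (hup.orbitLowerRow_of_floor hκhi' hκlo' hlo'') hhi'' hq hW

/-! ## §5 One-point route (OP1-E / OP1-S node shapes) at any anchor, incl. the one-point fast layer -/

section OnePoint

variable {tp U n : ℝ} {hi c' : ℚ} {c A κ u ν : ℝ}

/-- **OP1-E orbit-state node at `(U, n, t′)` ⇒ the leaf at the sharp (Koma–Tasaki tower) constant `M²`**,
`M = −(c − A + (Σμ)(n/2 − ν))`: point group `S ≠ ∅` with `b1gSign = 1` on `S`, window `Λ' ⊇ pairRegion {0,±e₁,±e₂} 0` fitting the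
tori of side `≥ L₁`, `κ ≥ 0`, cap `e₀(U, n, t′) ≤ hi ≤ u`, `0 ≤ U`, `0 ≤ n < 2`; leaf at every `c' ≥ M²` (the KHvdL reading `2M²`
follows by `.mono`). [cite: KomaTasaki1994, Theorem 5] -/
theorem ObsPairLROCeilingAt_of_onePoint_orbitState_bound_sq (hU : 0 ≤ U) (hn0 : 0 ≤ n) (hn2 : n < 2)
    (μ : Fin 2 → ℝ) (hκ : 0 ≤ κ) (hE : energyDensityTT' 1 tp U n ≤ ((hi : ℚ) : ℝ)) (hhi : ((hi : ℚ) : ℝ) ≤ u)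
    {S : Finset (DihedralGroup 4)} (hS : S.Nonempty) (hS1 : ∀ γ ∈ S, b1gSign γ = 1)
    {Λ' : Finset (Site 2)} (h0 : pairRegion (insert (0 : Site 2) unitSteps) 0 ⊆ Λ') (L₁ : ℕ)
    (hInj : ∀ L : ℕ, L₁ ≤ L → Set.InjOn (Torus.proj (d := 2) L) ↑Λ')
    (hbound : ∀ (L : ℕ) [NeZero L] (hL : L₁ ≤ L) (ζ : Fock (Orb (FermionTorus 2 L))), star ζ ⬝ᵥ ζ = 1 →
      c - A + ∑ σ : Fin 2, μ σ *
          ((star ζ ⬝ᵥ ((∑ y : FermionTorus 2 L, numberOp y σ) *ᵥ ζ)).re / (L : ℝ) ^ 2 - ν) +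
        κ * (u - (star ζ ⬝ᵥ (hubbardTorusTT' L 1 tp U *ᵥ ζ)).re / (L : ℝ) ^ 2) ≤
        (orbitState (spaceGroupUnitary S) ζ (fermionEmbed (PolySite.toTorusEmb L (hInj L hL))
          (-(fermionEmbed (PolySite.incl h0)
            (localPairAt (insert (0 : Site 2) unitSteps) dWaveFormFactor 0))))).re)
    (hc' : (c - A + (∑ σ : Fin 2, μ σ) * (n / 2 - ν)) ^ 2 ≤ ((c' : ℚ) : ℝ)) :
    ObsPairLROCeilingAt tp U n c' := by
  intro ψ hψ hψ1
  have hg : ∀ γ ∈ S, ∀ e ∈ insert (0 : Site 2) unitSteps, dWaveFormFactor (d4Vec γ e) = dWaveFormFactor e :=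
    fun γ hγ e _ => dWaveFormFactor_d4Vec_of_b1gSign_eq_one (hS1 γ hγ) e
  exact (liminf_pairFieldLRO_le_sq_of_onePoint_orbitState_bound_TT' dWaveFormFactor 1 tp hU hn0 hn2 μ hκ
    (hE.trans hhi) hS hg h0 L₁ hInj hbound ψ hψ hψ1).trans hc'

/-- **THE ONE-POINT FAST LAYER (OP1-E, sharp constant).** The SAME node (certified at cap `u` with energy multiplier `κ ≥ 0`)
read under ANY certified cap `e₀(U, n, t′) ≤ hi` (no relation to `u` needed) gives the leaf at every
`c' ≥ (c − A + (Σμ)(n/2 − ν) + κ(u − hi))²`, i.e. `M' = M − κ(u − hi)`: the node's own term `κ(u − ⟨H⟩/L²)` is affine in the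
energy, so a better cap `hi < u` re-prices the one-point ceiling DOWN by exactly `κ·(u − hi)` at zero solves (an improvement
whenever `0 ≤ κ(u − hi) ≤ 2M`). [cite: BoydVandenberghe2004, §5.6] [cite: KomaTasaki1994, Theorem 5] -/
theorem ObsPairLROCeilingAt_of_onePoint_orbitState_bound_sq_reprice (hU : 0 ≤ U) (hn0 : 0 ≤ n) (hn2 : n < 2)
    (μ : Fin 2 → ℝ) (hκ : 0 ≤ κ) (hE : energyDensityTT' 1 tp U n ≤ ((hi : ℚ) : ℝ))
    {S : Finset (DihedralGroup 4)} (hS : S.Nonempty) (hS1 : ∀ γ ∈ S, b1gSign γ = 1)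
    {Λ' : Finset (Site 2)} (h0 : pairRegion (insert (0 : Site 2) unitSteps) 0 ⊆ Λ') (L₁ : ℕ)
    (hInj : ∀ L : ℕ, L₁ ≤ L → Set.InjOn (Torus.proj (d := 2) L) ↑Λ')
    (hbound : ∀ (L : ℕ) [NeZero L] (hL : L₁ ≤ L) (ζ : Fock (Orb (FermionTorus 2 L))), star ζ ⬝ᵥ ζ = 1 →
      c - A + ∑ σ : Fin 2, μ σ *
          ((star ζ ⬝ᵥ ((∑ y : FermionTorus 2 L, numberOp y σ) *ᵥ ζ)).re / (L : ℝ) ^ 2 - ν) +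
        κ * (u - (star ζ ⬝ᵥ (hubbardTorusTT' L 1 tp U *ᵥ ζ)).re / (L : ℝ) ^ 2) ≤
        (orbitState (spaceGroupUnitary S) ζ (fermionEmbed (PolySite.toTorusEmb L (hInj L hL))
          (-(fermionEmbed (PolySite.incl h0)
            (localPairAt (insert (0 : Site 2) unitSteps) dWaveFormFactor 0))))).re)
    (hc' : (c - A + (∑ σ : Fin 2, μ σ) * (n / 2 - ν) + κ * (u - ((hi : ℚ) : ℝ))) ^ 2 ≤ ((c' : ℚ) : ℝ)) :
    ObsPairLROCeilingAt tp U n c' := by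
  have hc'' : (c + κ * (u - ((hi : ℚ) : ℝ)) - A + (∑ σ : Fin 2, μ σ) * (n / 2 - ν)) ^ 2 ≤ ((c' : ℚ) : ℝ) := by
    have : c + κ * (u - ((hi : ℚ) : ℝ)) - A + (∑ σ : Fin 2, μ σ) * (n / 2 - ν) =
        c - A + (∑ σ : Fin 2, μ σ) * (n / 2 - ν) + κ * (u - ((hi : ℚ) : ℝ)) := by ring
    rw [this]; exact hc'
  refine ObsPairLROCeilingAt_of_onePoint_orbitState_bound_sq (c := c + κ * (u - ((hi : ℚ) : ℝ)))
    (u := ((hi : ℚ) : ℝ)) hU hn0 hn2 μ hκ hE le_rfl hS hS1 h0 L₁ hInj ?_ hc''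
  intro L _ hL ζ hζ
  convert hbound L hL ζ hζ using 1
  ring

/-- **OP1-S orbit-state node at `(U, n, t′)` (neutral equation-of-motion term explicit) ⇒ the leaf at the sharp constant `M²`.**
As `ObsPairLROCeilingAt_of_onePoint_orbitState_bound_sq` with `0 < n` and ONE more datum: a number-conserving word
`X ∈ 𝔄_{Λ'}` (`[N̂_{Λ'}, X] = 0`) whose term `Re ω̄_ζ(H_L Γ_L X − Γ_L X H_L)` is added on the left of the node inequality
(`liminf_pairFieldLRO_le_sq_of_onePoint_stationary_orbitState_bound_TT'`, p1 g6). [cite: KomaTasaki1994, Theorem 5] -/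
theorem ObsPairLROCeilingAt_of_onePoint_stationary_orbitState_bound_sq (hU : 0 ≤ U) (hn0 : 0 < n) (hn2 : n < 2)
    (μ : Fin 2 → ℝ) (hκ : 0 ≤ κ) (hE : energyDensityTT' 1 tp U n ≤ ((hi : ℚ) : ℝ)) (hhi : ((hi : ℚ) : ℝ) ≤ u)
    {S : Finset (DihedralGroup 4)} (hS : S.Nonempty) (hS1 : ∀ γ ∈ S, b1gSign γ = 1)
    {Λ' : Finset (Site 2)} (h0 : pairRegion (insert (0 : Site 2) unitSteps) 0 ⊆ Λ')
    (X : FermionOp Λ') (hXN : Commute totalNumberOp X) (L₁ : ℕ)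
    (hInj : ∀ L : ℕ, L₁ ≤ L → Set.InjOn (Torus.proj (d := 2) L) ↑Λ')
    (hbound : ∀ (L : ℕ) [NeZero L] (hL : L₁ ≤ L) (ζ : Fock (Orb (FermionTorus 2 L))), star ζ ⬝ᵥ ζ = 1 →
      c - A + ∑ σ : Fin 2, μ σ *
          ((star ζ ⬝ᵥ ((∑ y : FermionTorus 2 L, numberOp y σ) *ᵥ ζ)).re / (L : ℝ) ^ 2 - ν) +
        κ * (u - (star ζ ⬝ᵥ (hubbardTorusTT' L 1 tp U *ᵥ ζ)).re / (L : ℝ) ^ 2) +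
        (orbitState (spaceGroupUnitary S) ζ
          (hubbardTorusTT' L 1 tp U * fermionEmbed (PolySite.toTorusEmb L (hInj L hL)) X -
            fermionEmbed (PolySite.toTorusEmb L (hInj L hL)) X * hubbardTorusTT' L 1 tp U)).re ≤
        (orbitState (spaceGroupUnitary S) ζ (fermionEmbed (PolySite.toTorusEmb L (hInj L hL))
          (-(fermionEmbed (PolySite.incl h0)
            (localPairAt (insert (0 : Site 2) unitSteps) dWaveFormFactor 0))))).re)
    (hc' : (c - A + (∑ σ : Fin 2, μ σ) * (n / 2 - ν)) ^ 2 ≤ ((c' : ℚ) : ℝ)) :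
    ObsPairLROCeilingAt tp U n c' := by
  intro ψ hψ hψ1
  have hg : ∀ γ ∈ S, ∀ e ∈ insert (0 : Site 2) unitSteps, dWaveFormFactor (d4Vec γ e) = dWaveFormFactor e :=
    fun γ hγ e _ => dWaveFormFactor_d4Vec_of_b1gSign_eq_one (hS1 γ hγ) e
  exact (liminf_pairFieldLRO_le_sq_of_onePoint_stationary_orbitState_bound_TT' dWaveFormFactor 1 tp hU hn0 hn2 μ hκ
    (hE.trans hhi) hS hg h0 X hXN L₁ hInj hbound ψ hψ hψ1).trans hc'

/-- **THE ONE-POINT FAST LAYER (OP1-S).** The OP1-S node certified at cap `u` (multiplier `κ ≥ 0`) read under ANY certified cap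
`e₀(U, n, t′) ≤ hi` gives the leaf at every `c' ≥ (c − A + (Σμ)(n/2 − ν) + κ(u − hi))²`. [cite: BoydVandenberghe2004, §5.6]
[cite: KomaTasaki1994, Theorem 5] -/
theorem ObsPairLROCeilingAt_of_onePoint_stationary_orbitState_bound_sq_reprice (hU : 0 ≤ U) (hn0 : 0 < n) (hn2 : n < 2)
    (μ : Fin 2 → ℝ) (hκ : 0 ≤ κ) (hE : energyDensityTT' 1 tp U n ≤ ((hi : ℚ) : ℝ))
    {S : Finset (DihedralGroup 4)} (hS : S.Nonempty) (hS1 : ∀ γ ∈ S, b1gSign γ = 1)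
    {Λ' : Finset (Site 2)} (h0 : pairRegion (insert (0 : Site 2) unitSteps) 0 ⊆ Λ')
    (X : FermionOp Λ') (hXN : Commute totalNumberOp X) (L₁ : ℕ)
    (hInj : ∀ L : ℕ, L₁ ≤ L → Set.InjOn (Torus.proj (d := 2) L) ↑Λ')
    (hbound : ∀ (L : ℕ) [NeZero L] (hL : L₁ ≤ L) (ζ : Fock (Orb (FermionTorus 2 L))), star ζ ⬝ᵥ ζ = 1 →
      c - A + ∑ σ : Fin 2, μ σ *
          ((star ζ ⬝ᵥ ((∑ y : FermionTorus 2 L, numberOp y σ) *ᵥ ζ)).re / (L : ℝ) ^ 2 - ν) +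
        κ * (u - (star ζ ⬝ᵥ (hubbardTorusTT' L 1 tp U *ᵥ ζ)).re / (L : ℝ) ^ 2) +
        (orbitState (spaceGroupUnitary S) ζ
          (hubbardTorusTT' L 1 tp U * fermionEmbed (PolySite.toTorusEmb L (hInj L hL)) X -
            fermionEmbed (PolySite.toTorusEmb L (hInj L hL)) X * hubbardTorusTT' L 1 tp U)).re ≤
        (orbitState (spaceGroupUnitary S) ζ (fermionEmbed (PolySite.toTorusEmb L (hInj L hL))
          (-(fermionEmbed (PolySite.incl h0)
            (localPairAt (insert (0 : Site 2) unitSteps) dWaveFormFactor 0))))).re)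
    (hc' : (c - A + (∑ σ : Fin 2, μ σ) * (n / 2 - ν) + κ * (u - ((hi : ℚ) : ℝ))) ^ 2 ≤ ((c' : ℚ) : ℝ)) :
    ObsPairLROCeilingAt tp U n c' := by
  have hc'' : (c + κ * (u - ((hi : ℚ) : ℝ)) - A + (∑ σ : Fin 2, μ σ) * (n / 2 - ν)) ^ 2 ≤ ((c' : ℚ) : ℝ) := by
    have : c + κ * (u - ((hi : ℚ) : ℝ)) - A + (∑ σ : Fin 2, μ σ) * (n / 2 - ν) =
        c - A + (∑ σ : Fin 2, μ σ) * (n / 2 - ν) + κ * (u - ((hi : ℚ) : ℝ)) := by ring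
    rw [this]; exact hc'
  refine ObsPairLROCeilingAt_of_onePoint_stationary_orbitState_bound_sq (c := c + κ * (u - ((hi : ℚ) : ℝ)))
    (u := ((hi : ℚ) : ℝ)) hU hn0 hn2 μ hκ hE le_rfl hS hS1 h0 X hXN L₁ hInj ?_ hc''
  intro L _ hL ζ hζ
  convert hbound L hL ζ hζ using 1
  ring

/-- **`t′ = 0` vocabulary (OP1-E, sharp constant).** At a `t′ = 0` anchor the node may be typed with `hubbardTorus 2 L 1 U`
(the tree's `t′ = 0` Hamiltonian, `hubbardTorusTT'_zero`); this reads it into `ObsPairLROCeilingAt 0 U n c'` in one application.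
[cite: KomaTasaki1994, Theorem 5] -/
theorem ObsPairLROCeilingAt_tp0_of_onePoint_orbitState_bound_sq (hU : 0 ≤ U) (hn0 : 0 ≤ n) (hn2 : n < 2)
    (μ : Fin 2 → ℝ) (hκ : 0 ≤ κ) (hE : energyDensityTT' 1 0 U n ≤ ((hi : ℚ) : ℝ)) (hhi : ((hi : ℚ) : ℝ) ≤ u)
    {S : Finset (DihedralGroup 4)} (hS : S.Nonempty) (hS1 : ∀ γ ∈ S, b1gSign γ = 1)
    {Λ' : Finset (Site 2)} (h0 : pairRegion (insert (0 : Site 2) unitSteps) 0 ⊆ Λ') (L₁ : ℕ)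
    (hInj : ∀ L : ℕ, L₁ ≤ L → Set.InjOn (Torus.proj (d := 2) L) ↑Λ')
    (hbound : ∀ (L : ℕ) [NeZero L] (hL : L₁ ≤ L) (ζ : Fock (Orb (FermionTorus 2 L))), star ζ ⬝ᵥ ζ = 1 →
      c - A + ∑ σ : Fin 2, μ σ *
          ((star ζ ⬝ᵥ ((∑ y : FermionTorus 2 L, numberOp y σ) *ᵥ ζ)).re / (L : ℝ) ^ 2 - ν) +
        κ * (u - (star ζ ⬝ᵥ (hubbardTorus 2 L 1 U *ᵥ ζ)).re / (L : ℝ) ^ 2) ≤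
        (orbitState (spaceGroupUnitary S) ζ (fermionEmbed (PolySite.toTorusEmb L (hInj L hL))
          (-(fermionEmbed (PolySite.incl h0)
            (localPairAt (insert (0 : Site 2) unitSteps) dWaveFormFactor 0))))).re)
    (hc' : (c - A + (∑ σ : Fin 2, μ σ) * (n / 2 - ν)) ^ 2 ≤ ((c' : ℚ) : ℝ)) :
    ObsPairLROCeilingAt 0 U n c' := by
  refine ObsPairLROCeilingAt_of_onePoint_orbitState_bound_sq hU hn0 hn2 μ hκ hE hhi hS hS1 h0 L₁ hInj ?_ hc'
  intro L _ hL ζ hζ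
  rw [hubbardTorusTT'_zero]
  exact hbound L hL ζ hζ

end OnePoint

end Summit.Ventures.CertifiedManyBodySolver.Observables

end
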